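import Mathlib
import Summits.Ventures.HodgeRepro.Tier4.Line4.PlacePart
import Summits.Ventures.HodgeRepro.Tier4.Line4.TorusProduct
import Summits.Ventures.HodgeRepro.Tier4.Line4.TorusProductHaar
import Summits.Ventures.HodgeRepro.Tier4.Line4.FinitePartClosed

/-!
# Tier4/Line4/TorusFinSplit — the `S`-split of the finite torus along a set `S` of finite places: `T_f ≃ₜ* T_S × T_f^{(S)}`
(C-L4-PSPLIT, Part A.2)

Blind re-derivation cell `pub-hodge-repro`, Tier 4 «prove the step» (README §9–§10), seat t4-L2-p1 (gen 3; plan-4 g5's cut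
C-L4-PSPLIT S15510, statement S15526).  Tree path `lean/Summits/Ventures/HodgeRepro/Tier4/Line4/TorusFinSplit.lean`.
Definitions lane.  Imports `Line4/PlacePart` (the parts and their laws), `Line4/TorusProduct`
(`torusFin`, `torusFin'`), `Line4/TorusProductHaar` (local compactness / second countability of `T_f`, `T′_f`),
`Line4/FinitePartClosed`.  Mathlib-level; no literature.

* `torusFinAt W S ≤ T_f` — the elements supported on `S` (`T_S = ∏_{v ∈ S} T(k_v)`, the `S`-component); `torusFinAway W S
  ≤ T_f` — the elements trivial on `S` (`T_f^{(S)}`, the restricted product away from `S`); `atTf`, `awayTf` the two parts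
  of a finite torus element (`GA.ofPlacesPart`, `GA.offPlacesPart` on the coordinates).  `S = {v : v ∣ p}` is the split of
  record for the level sequence `p^n`.
* **`torusFinSplit W S : T_f ≃ₜ* T_S × T_f^{(S)}`**, `b ↦ (b_S, b^{(S)})`, inverse `(x, y) ↦ x · y`
  (`ofPlacesPart_mul_offPlacesPart_of_mem` and the four idempotence laws of PlacePart give `left_inv` / `right_inv`;
  `map_mul` from `ofPlacesPart_mul` / `offPlacesPart_mul`).  `torusFinSplit_symm_apply` is `rfl`.
* Both factors are closed in `T_f` (`isClosed_torusFinAt`, `isClosed_torusFinAway`: `supportedOn S` and `trivialOn S` are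
  closed in `G(𝔸)`, the component conditions being closed as `adComponentFin` is continuous), hence locally compact and
  second countable — the hypotheses of the generic Haar transport (`Common.exists_smul_map_symm_prod_eq`, applied in
  `Line4/TorusFinSplitHaar`).
* The `T′` twins: `torusFinAt'`, `torusFinAway'`, `atTf'`, `awayTf'`, `torusFinSplit'`, and their closedness.

Nothing here says anything about the status of the Hodge conjecture for CM abelian varieties, which is NOT proved
(HC_CM is NOT proved by anyone in this repository).
-/

set_option autoImplicit false
noncomputable section
namespace Summit.Ventures.HodgeRepro.Tier4.Line4
open Summit.Ventures.HodgeRepro.Tier4 Summit.Ventures.HodgeRepro.Tier4.Common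
  Summit.Ventures.HodgeRepro.Tier4.Line1 NumberField IsDedekindDomain Matrix
open scoped NumberField

section Closed
variable {k : Type} [Field k] [NumberField k] (W : PlaneData k)

/-- The `v`-component of the adeles is continuous. -/
theorem continuous_adComponentFin (v : HeightOneSpectrum (𝓞 k)) : Continuous (adComponentFin k v) :=
  (RestrictedProduct.continuous_eval v).comp continuous_snd

/-- `{g | finiteComponent v g = 1}` is closed in `G(𝔸)`. -/
theorem isClosed_finiteComponent_eq_one (v : HeightOneSpectrum (𝓞 k)) :
    IsClosed {g : GA W | GA.finiteComponent W v g = 1} := by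
  have hmat : ∀ i j, Continuous fun g : GA W => GA.mat W g i j :=
    fun i j => (Units.continuous_val.comp continuous_subtype_val).matrix_elem i j
  have : {g : GA W | GA.finiteComponent W v g = 1} = ⋂ i, ⋂ j,
      {g : GA W | adComponentFin k v (GA.mat W g i j) = (1 : Matrix (Fin 4) (Fin 4) (v.adicCompletion k)) i j} := by
    ext g
    simp only [Set.mem_setOf_eq, Set.mem_iInter]
    exact finiteComponent_eq_one_iff W v g
  rw [this]
  refine isClosed_iInter fun i => isClosed_iInter fun j => isClosed_eq ?_ continuous_const
  exact (continuous_adComponentFin v).comp (hmat i j)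

/-- The elements trivial on `S` form a closed subgroup of `G(𝔸)`. -/
theorem isClosed_trivialOn (S : Set (HeightOneSpectrum (𝓞 k))) : IsClosed (trivialOn W S : Set (GA W)) := by
  have : (trivialOn W S : Set (GA W)) = ⋂ w ∈ S, {g : GA W | GA.finiteComponent W w g = 1} := by
    ext g
    simp only [SetLike.mem_coe, Set.mem_iInter, Set.mem_setOf_eq]
    exact mem_trivialOn W S g
  rw [this]
  exact isClosed_biInter fun w _ => isClosed_finiteComponent_eq_one W w

/-- The elements supported on `S` form a closed subgroup of `G(𝔸)`. -/
theorem isClosed_supportedOn (S : Set (HeightOneSpectrum (𝓞 k))) : IsClosed (supportedOn W S : Set (GA W)) := by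
  have : (supportedOn W S : Set (GA W)) =
      (⋂ w ∈ ({w : HeightOneSpectrum (𝓞 k) | w ∉ S}), {g : GA W | GA.finiteComponent W w g = 1}) ∩
        (finitePart W : Set (GA W)) := by
    ext g
    simp only [SetLike.mem_coe, Set.mem_inter_iff, Set.mem_iInter, Set.mem_setOf_eq]
    constructor
    · rintro ⟨h1, h2⟩
      exact ⟨fun w hw => h1 w hw, (mem_finitePart W g).2 h2⟩
    · rintro ⟨h1, h2⟩
      exact ⟨fun w hw => h1 w hw, (mem_finitePart W g).1 h2⟩
  rw [this]
  exact (isClosed_biInter fun w _ => isClosed_finiteComponent_eq_one W w).inter (isClosed_finitePart W)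

end Closed

section Split
variable {k : Type} [Field k] [NumberField k] (W : PlaneData k) (S : Set (HeightOneSpectrum (𝓞 k)))

/-- The inclusion `T_f → G(𝔸)`. -/
def finInc : torusFin W →* GA W := (torusT W).subtype.comp (torusFin W).subtype

/-- `finInc` is the double coercion. -/
theorem finInc_apply (b : torusFin W) : finInc W b = ((b : torusT W) : GA W) := rfl

/-- **`T_v ≤ T_f`**: the finite torus elements supported on `S` (the `S`-component of the torus). -/
def torusFinAt : Subgroup (torusFin W) := (supportedOn W S).comap (finInc W)

/-- **`T_f^{(v)} ≤ T_f`**: the finite torus elements trivial on `S` (the restricted product away from `S`). -/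
def torusFinAway : Subgroup (torusFin W) := (trivialOn W S).comap (finInc W)

/-- Membership in `T_S`. -/
theorem mem_torusFinAt (b : torusFin W) : b ∈ torusFinAt W S ↔ ((b : torusT W) : GA W) ∈ supportedOn W S := Iff.rfl

/-- Membership in `T_f^{(S)}`. -/
theorem mem_torusFinAway (b : torusFin W) :
    b ∈ torusFinAway W S ↔ ((b : torusT W) : GA W) ∈ trivialOn W S := by
  rw [torusFinAway, Subgroup.mem_comap, finInc_apply]

/-- `T_S` is closed in `T_f`. -/
theorem isClosed_torusFinAt : IsClosed (torusFinAt W S : Set (torusFin W)) :=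
  (isClosed_supportedOn W S).preimage (continuous_subtype_val.comp continuous_subtype_val)

/-- `T_f^{(S)}` is closed in `T_f`. -/
theorem isClosed_torusFinAway : IsClosed (torusFinAway W S : Set (torusFin W)) :=
  (isClosed_trivialOn W S).preimage (continuous_subtype_val.comp continuous_subtype_val)

/-- `T_S` is locally compact. -/
theorem locallyCompact_torusFinAt : LocallyCompactSpace (torusFinAt W S) := by
  haveI := locallyCompact_torusFin W
  exact (isClosed_torusFinAt W S).locallyCompactSpace

/-- `T_f^{(S)}` is locally compact. -/
theorem locallyCompact_torusFinAway : LocallyCompactSpace (torusFinAway W S) := by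
  haveI := locallyCompact_torusFin W
  exact (isClosed_torusFinAway W S).locallyCompactSpace

/-- `T_S` is second countable. -/
theorem secondCountable_torusFinAt : SecondCountableTopology (torusFinAt W S) := by
  haveI := secondCountable_torusFin W
  exact Topology.IsEmbedding.subtypeVal.secondCountableTopology

/-- `T_f^{(S)}` is second countable. -/
theorem secondCountable_torusFinAway : SecondCountableTopology (torusFinAway W S) := by
  haveI := secondCountable_torusFin W
  exact Topology.IsEmbedding.subtypeVal.secondCountableTopology

/-- The `S`-part of a finite torus element, in `T_S`. -/
def atTf (b : torusFin W) : torusFinAt W S :=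
  ⟨⟨⟨GA.ofPlacesPart W S ((b : torusT W) : GA W), ofPlacesPart_mem_torusT W S (b : torusT W).2⟩,
    show GA.ofPlacesPart W S ((b : torusT W) : GA W) ∈ finitePart W from ofPlacesPart_mem_finitePart W S _⟩,
    show GA.ofPlacesPart W S ((b : torusT W) : GA W) ∈ supportedOn W S from ofPlacesPart_mem_supportedOn W S _⟩

/-- The away part of a finite torus element, in `T_f^{(S)}`. -/
def awayTf (b : torusFin W) : torusFinAway W S :=
  ⟨⟨⟨GA.offPlacesPart W S ((b : torusT W) : GA W), offPlacesPart_mem_torusT W S (b : torusT W).2⟩,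
    show GA.offPlacesPart W S ((b : torusT W) : GA W) ∈ finitePart W from offPlacesPart_mem_finitePart W S _⟩,
    (mem_torusFinAway W S _).2 (offPlacesPart_mem_trivialOn W S _)⟩

/-- The coordinates of `atTf`. -/
theorem coe_atTf (b : torusFin W) :
    ((((atTf W S b : torusFin W) : torusT W)) : GA W) = GA.ofPlacesPart W S ((b : torusT W) : GA W) := rfl

/-- The coordinates of `awayTf`. -/
theorem coe_awayTf (b : torusFin W) :
    ((((awayTf W S b : torusFin W) : torusT W)) : GA W) = GA.offPlacesPart W S ((b : torusT W) : GA W) := rfl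

/-- `atTf` is continuous. -/
theorem continuous_atTf : Continuous (atTf W S) :=
  Continuous.subtype_mk (Continuous.subtype_mk (Continuous.subtype_mk
    ((continuous_ofPlacesPart W S).comp (continuous_subtype_val.comp continuous_subtype_val)) _) _) _

/-- `awayTf` is continuous. -/
theorem continuous_awayTf : Continuous (awayTf W S) :=
  Continuous.subtype_mk (Continuous.subtype_mk (Continuous.subtype_mk
    ((continuous_offPlacesPart W S).comp (continuous_subtype_val.comp continuous_subtype_val)) _) _) _

/-- **THE `v`-SPLIT OF THE FINITE TORUS `T_f ≃ₜ* T_v × T_f^{(v)}`**: `b ↦ (b_v, b^{(v)})`, inverse `(x, y) ↦ x · y`; a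
continuous group isomorphism. -/
def torusFinSplit : torusFin W ≃ₜ* torusFinAt W S × torusFinAway W S where
  toFun b := (atTf W S b, awayTf W S b)
  invFun p := (p.1 : torusFin W) * (p.2 : torusFin W)
  left_inv := by
    intro b
    apply Subtype.ext
    apply Subtype.ext
    exact ofPlacesPart_mul_offPlacesPart_of_mem W S b.2
  right_inv := by
    rintro ⟨x, y⟩
    have hx : (((x : torusFin W) : torusT W) : GA W) ∈ supportedOn W S := x.2
    have hy : (((y : torusFin W) : torusT W) : GA W) ∈ trivialOn W S := (mem_torusFinAway W S _).1 y.2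
    have hyf : (((y : torusFin W) : torusT W) : GA W) ∈ finitePart W := (y : torusFin W).2
    refine Prod.ext ?_ ?_
    · apply Subtype.ext
      apply Subtype.ext
      apply Subtype.ext
      change GA.ofPlacesPart W S ((((x : torusFin W) : torusT W) : GA W) * (((y : torusFin W) : torusT W) : GA W)) =
        (((x : torusFin W) : torusT W) : GA W)
      rw [ofPlacesPart_mul, ofPlacesPart_eq_self_of_mem_supportedOn W S hx,
        ofPlacesPart_eq_one_of_mem_trivialOn W S hy, mul_one]
    · apply Subtype.ext
      apply Subtype.ext
      apply Subtype.ext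
      change GA.offPlacesPart W S ((((x : torusFin W) : torusT W) : GA W) * (((y : torusFin W) : torusT W) : GA W)) =
        (((y : torusFin W) : torusT W) : GA W)
      rw [offPlacesPart_mul, offPlacesPart_eq_one_of_mem_supportedOn W S hx,
        offPlacesPart_eq_self_of_mem_trivialOn W S hyf hy, one_mul]
  map_mul' := by
    intro s t
    refine Prod.ext ?_ ?_
    · apply Subtype.ext
      apply Subtype.ext
      apply Subtype.ext
      exact ofPlacesPart_mul W S _ _
    · apply Subtype.ext
      apply Subtype.ext
      apply Subtype.ext
      exact offPlacesPart_mul W S _ _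
  continuous_toFun := (continuous_atTf W S).prodMk (continuous_awayTf W S)
  continuous_invFun := (continuous_subtype_val.comp continuous_fst).mul (continuous_subtype_val.comp continuous_snd)

/-- The inverse of the split is the product. -/
theorem torusFinSplit_symm_apply (p : torusFinAt W S × torusFinAway W S) :
    (torusFinSplit W S).symm p = (p.1 : torusFin W) * (p.2 : torusFin W) := rfl

/-- The split, componentwise. -/
theorem torusFinSplit_apply (b : torusFin W) : torusFinSplit W S b = (atTf W S b, awayTf W S b) := rfl

end Split

section Split'
variable {k : Type} [Field k] [NumberField k] (W : PlaneData k) (S : Set (HeightOneSpectrum (𝓞 k)))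

/-- The inclusion `T′_f → G(𝔸)`. -/
def finInc' : torusFin' W →* GA W := (torusT' W).subtype.comp (torusFin' W).subtype

/-- `finInc'` is the double coercion. -/
theorem finInc'_apply (b : torusFin' W) : finInc' W b = ((b : torusT' W) : GA W) := rfl

/-- **`T′_v ≤ T′_f`**: the `T′`-twin of `torusFinAt`. -/
def torusFinAt' : Subgroup (torusFin' W) := (supportedOn W S).comap (finInc' W)

/-- **`T′_f^{(v)} ≤ T′_f`**: the `T′`-twin of `torusFinAway`. -/
def torusFinAway' : Subgroup (torusFin' W) := (trivialOn W S).comap (finInc' W)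

/-- Membership in `T′_S`. -/
theorem mem_torusFinAt' (b : torusFin' W) :
    b ∈ torusFinAt' W S ↔ ((b : torusT' W) : GA W) ∈ supportedOn W S := Iff.rfl

/-- Membership in `T′_f^{(S)}`. -/
theorem mem_torusFinAway' (b : torusFin' W) :
    b ∈ torusFinAway' W S ↔ ((b : torusT' W) : GA W) ∈ trivialOn W S := by
  rw [torusFinAway', Subgroup.mem_comap, finInc'_apply]

/-- `T′_S` is closed in `T′_f`. -/
theorem isClosed_torusFinAt' : IsClosed (torusFinAt' W S : Set (torusFin' W)) :=
  (isClosed_supportedOn W S).preimage (continuous_subtype_val.comp continuous_subtype_val)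

/-- `T′_f^{(S)}` is closed in `T′_f`. -/
theorem isClosed_torusFinAway' : IsClosed (torusFinAway' W S : Set (torusFin' W)) :=
  (isClosed_trivialOn W S).preimage (continuous_subtype_val.comp continuous_subtype_val)

/-- `T′_S` is locally compact. -/
theorem locallyCompact_torusFinAt' : LocallyCompactSpace (torusFinAt' W S) := by
  haveI := locallyCompact_torusFin' W
  exact (isClosed_torusFinAt' W S).locallyCompactSpace

/-- `T′_f^{(S)}` is locally compact. -/
theorem locallyCompact_torusFinAway' : LocallyCompactSpace (torusFinAway' W S) := by
  haveI := locallyCompact_torusFin' W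
  exact (isClosed_torusFinAway' W S).locallyCompactSpace

/-- `T′_S` is second countable. -/
theorem secondCountable_torusFinAt' : SecondCountableTopology (torusFinAt' W S) := by
  haveI := secondCountable_torusFin' W
  exact Topology.IsEmbedding.subtypeVal.secondCountableTopology

/-- `T′_f^{(S)}` is second countable. -/
theorem secondCountable_torusFinAway' : SecondCountableTopology (torusFinAway' W S) := by
  haveI := secondCountable_torusFin' W
  exact Topology.IsEmbedding.subtypeVal.secondCountableTopology

/-- The `S`-part of a finite `T′`-element, in `T′_S`. -/
def atTf' (b : torusFin' W) : torusFinAt' W S :=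
  ⟨⟨⟨GA.ofPlacesPart W S ((b : torusT' W) : GA W), ofPlacesPart_mem_torusT' W S (b : torusT' W).2⟩,
    show GA.ofPlacesPart W S ((b : torusT' W) : GA W) ∈ finitePart W from ofPlacesPart_mem_finitePart W S _⟩,
    show GA.ofPlacesPart W S ((b : torusT' W) : GA W) ∈ supportedOn W S from ofPlacesPart_mem_supportedOn W S _⟩

/-- The away part of a finite `T′`-element, in `T′_f^{(S)}`. -/
def awayTf' (b : torusFin' W) : torusFinAway' W S :=
  ⟨⟨⟨GA.offPlacesPart W S ((b : torusT' W) : GA W), offPlacesPart_mem_torusT' W S (b : torusT' W).2⟩,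
    show GA.offPlacesPart W S ((b : torusT' W) : GA W) ∈ finitePart W from offPlacesPart_mem_finitePart W S _⟩,
    (mem_torusFinAway' W S _).2 (offPlacesPart_mem_trivialOn W S _)⟩

/-- The coordinates of `atTf'`. -/
theorem coe_atTf' (b : torusFin' W) :
    ((((atTf' W S b : torusFin' W) : torusT' W)) : GA W) = GA.ofPlacesPart W S ((b : torusT' W) : GA W) := rfl

/-- The coordinates of `awayTf'`. -/
theorem coe_awayTf' (b : torusFin' W) :
    ((((awayTf' W S b : torusFin' W) : torusT' W)) : GA W) = GA.offPlacesPart W S ((b : torusT' W) : GA W) := rfl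

/-- `atTf'` is continuous. -/
theorem continuous_atTf' : Continuous (atTf' W S) :=
  Continuous.subtype_mk (Continuous.subtype_mk (Continuous.subtype_mk
    ((continuous_ofPlacesPart W S).comp (continuous_subtype_val.comp continuous_subtype_val)) _) _) _

/-- `awayTf'` is continuous. -/
theorem continuous_awayTf' : Continuous (awayTf' W S) :=
  Continuous.subtype_mk (Continuous.subtype_mk (Continuous.subtype_mk
    ((continuous_offPlacesPart W S).comp (continuous_subtype_val.comp continuous_subtype_val)) _) _) _

/-- **THE `S`-SPLIT OF `T′_f`**: `T′_f ≃ₜ* T′_v × T′_f^{(v)}`. -/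
def torusFinSplit' : torusFin' W ≃ₜ* torusFinAt' W S × torusFinAway' W S where
  toFun b := (atTf' W S b, awayTf' W S b)
  invFun p := (p.1 : torusFin' W) * (p.2 : torusFin' W)
  left_inv := by
    intro b
    apply Subtype.ext
    apply Subtype.ext
    exact ofPlacesPart_mul_offPlacesPart_of_mem W S b.2
  right_inv := by
    rintro ⟨x, y⟩
    have hx : (((x : torusFin' W) : torusT' W) : GA W) ∈ supportedOn W S := x.2
    have hy : (((y : torusFin' W) : torusT' W) : GA W) ∈ trivialOn W S := (mem_torusFinAway' W S _).1 y.2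
    have hyf : (((y : torusFin' W) : torusT' W) : GA W) ∈ finitePart W := (y : torusFin' W).2
    refine Prod.ext ?_ ?_
    · apply Subtype.ext
      apply Subtype.ext
      apply Subtype.ext
      change GA.ofPlacesPart W S ((((x : torusFin' W) : torusT' W) : GA W) * (((y : torusFin' W) : torusT' W) : GA W)) =
        (((x : torusFin' W) : torusT' W) : GA W)
      rw [ofPlacesPart_mul, ofPlacesPart_eq_self_of_mem_supportedOn W S hx,
        ofPlacesPart_eq_one_of_mem_trivialOn W S hy, mul_one]
    · apply Subtype.ext
      apply Subtype.ext
      apply Subtype.ext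
      change GA.offPlacesPart W S ((((x : torusFin' W) : torusT' W) : GA W) * (((y : torusFin' W) : torusT' W) : GA W)) =
        (((y : torusFin' W) : torusT' W) : GA W)
      rw [offPlacesPart_mul, offPlacesPart_eq_one_of_mem_supportedOn W S hx,
        offPlacesPart_eq_self_of_mem_trivialOn W S hyf hy, one_mul]
  map_mul' := by
    intro s t
    refine Prod.ext ?_ ?_
    · apply Subtype.ext
      apply Subtype.ext
      apply Subtype.ext
      exact ofPlacesPart_mul W S _ _
    · apply Subtype.ext
      apply Subtype.ext
      apply Subtype.ext
      exact offPlacesPart_mul W S _ _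
  continuous_toFun := (continuous_atTf' W S).prodMk (continuous_awayTf' W S)
  continuous_invFun := (continuous_subtype_val.comp continuous_fst).mul (continuous_subtype_val.comp continuous_snd)

/-- The inverse of the `T′`-split is the product. -/
theorem torusFinSplit'_symm_apply (p : torusFinAt' W S × torusFinAway' W S) :
    (torusFinSplit' W S).symm p = (p.1 : torusFin' W) * (p.2 : torusFin' W) := rfl

/-- The `T′`-split, componentwise. -/
theorem torusFinSplit'_apply (b : torusFin' W) : torusFinSplit' W S b = (atTf' W S b, awayTf' W S b) := rfl

end Split'

end Summit.Ventures.HodgeRepro.Tier4.Line4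

end
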